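import Summits.QuantumFields.QCD.Theorems.PauliWegnerSeaFMClosureUnquenchedSplitC3

/-!
# Crux `FMClosureUnquenched` (K2, stmt-QuantumFields-11512) — the crux AS TYPED from four sub-statements
# (crux-strategist decomposition, 2026-08-17; `--supports stmt-QuantumFields-11512`, closes nothing)

Seven lead seats (FINAL-c1, FINAL-c1b, LEAD-c1…c4 in `Cruxes/FMClosureUnquenched/`) and the standing disprover
(`Disproof.lean` §4 `core_imp_nnCriterion`, §5 `not_abstractFMClosureRepaired`) agree that the crux
`FMClosureUnquenched = K1 → K3 → ∀ N_f reg m > 0, Input → Conclusion` bundles four things: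

* (a) the OUTWARD fractional-moment bootstrap of Aizenman–Schenker–Friedrich–Hundertmark — LANDED modulo the averaged
  two-star package `∀ N_f, TwoStarBounds N_f` and far stability `∀ N_f, FarStability N_f`
  (`VonMisesCirclesC1.stub_closure`, p119549; K1/K3 are not needed);
* (b) INWARD decay inside every log window `a_k ‖v‖ ≤ K (1 + |log a_k|)` with a k-uniform constant — a different
  mechanism (reflection-positive log-convexity + a k-uniform short-distance bound), the genuinely new sub-crux;
* (c) the UNIT-SHELL corner `ℓ₀ = 1 ∧ β_k → 0` of the one-scale input as typed — isolated as `UnitShellLowerBound`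
  (a strong-coupling lower bound; mooted by any restatement with `2 ≤ ℓ₀`, cf. `Disproof.coreRepaired_of_core`);
* (d) full ranges `β_k ∈ ℝ`, bare masses anywhere — absorbed by the `(1+|β|)^p`, probe-mass-window typing of (a).

`fmClosureUnquenched_of_subs` is the kernel-checked implication  (a-inputs) → (b) → (c) → crux BY NAME, i.e. the glue
`TwoStarPackage → FarCollarStability → InwardCore → UnitShellSign → FMClosureUnquenched` of the route-level split of
K2 (children typed in the route file as let-inlined copies of the `…FMClosureUnquenchedDefs` bodies, definitionally
equal to the hypotheses below).  Everything used is landed: `stub_closure` (outward package from the input as typed),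
`collarResolventBounds_holds`, `hoppingDecay_holds`, `VonMisesCirclesC3.conclusion_of_outward_of_inward` (merge).
References: Aizenman–Schenker–Friedrich–Hundertmark, CMP 224 (2001) 219, §2 and Thm 2 [AizenmanEtAl2001].
-/

noncomputable section

namespace Summit.QuantumFields.QCD.Theorems.FMClosureUnquenchedSplit

open scoped BigOperators Topology
open MeasureTheory Filter
open Literature.MathematicalPhysics.QuantumFieldTheory Literature.MathematicalPhysics.QuantumLattice
  Literature.Probability.LatticeModels
open Summit.QuantumFields.QCD.Theorems.VonMisesCircles Summit.QuantumFields.QCD.Theorems.VonMisesCirclesC1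
  Summit.QuantumFields.QCD.Theorems.VonMisesCirclesC2 Summit.QuantumFields.QCD.Theorems.VonMisesCirclesC3

/-- **Sub-crux 3 (InwardCore, = `K2Split.CoreInward`)**: for every flavour number, regularisation and positive mass
tuple satisfying the one-scale `Input`, INSIDE every log window `a_k ‖v‖ ≤ K (1 + |log a_k|)` the phase-quenched
fractional moment decays at a physical rate with a k-uniform constant (its own exponent per `K`). -/
def InwardCore : Prop :=
  ∀ (Nf : ℕ) (reg : QCDRegularisation Nf) (m : Fin Nf → ℝ), (∀ f, 0 < m f) → Input Nf reg m →
    ∀ K : ℝ, ∃ s δ C : ℝ, 0 < s ∧ s < 1 ∧ 0 < δ ∧ ∀ᶠ k in atTop, ∀ S : ℕ, reg.L k ≤ S →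
      ∀ (f : Fin Nf) (v : Literature.Probability.LatticeModels.Site 4), v ∈ box 4 S →
        reg.a k * ‖v‖ ≤ K * (1 + |Real.log (reg.a k)|) →
          cruxMoment Nf (reg.β k) (bareMass reg m k) S f v s ≤ C * Real.exp (-(δ * (reg.a k * ‖v‖)))

/-- **The crux AS TYPED from its four sub-statements** (glue of the route-level split of K2): the averaged two-star
package and far stability feed the landed outward closure `stub_closure` (with the landed collar resolvent bounds and
hopping decay, and the unit-shell lower bound serving the corner `ℓ₀ = 1 ∧ |β_k| ≤ β₀` of the input as typed); the
outward package is read as an outward decay bound beyond `K₀ (1 + |log a_k|) ≤ a_k ‖v‖`; the inward core supplies the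
window; `conclusion_of_outward_of_inward` merges the two into the crux's `Conclusion` verbatim.  The crux's own
hypotheses K1 (`FibreCofactorDomination`) and K3 (`TiltedFlatness`) are not used. [cite: AizenmanEtAl2001, §2 and Thm 2] -/
theorem fmClosureUnquenched_of_subs
    (hT : ∀ Nf : ℕ, TwoStarBounds Nf) (hF : ∀ Nf : ℕ, FarStability Nf) (hIn : InwardCore)
    (hU : ∀ Nf : ℕ, UnitShellLowerBound Nf) :
    Summit.QuantumFields.QCD.Theses.PauliWegnerSea.FMClosureUnquenched := by
  rw [crux_iff]
  intro _hK1 _hK3 Nf reg m hm hin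
  obtain ⟨s, δ, C, K₀, ℓ₀, hs0, hs1, hδ, _hC, hwin, -, hdec⟩ :=
    stub_closure Nf reg m hm (hT Nf) (hF Nf) collarResolventBounds_holds (hU Nf) (hoppingDecay_holds Nf) hin
  refine conclusion_of_outward_of_inward reg m ⟨s, δ, C, K₀, hs0, hs1, hδ, ?_⟩ (hIn Nf reg m hm hin)
  filter_upwards [hwin, hdec] with k hkwin hk S hS f v hv hfar
  have hℓ : (ℓ₀ k f : ℝ) ≤ ‖v‖ := by
    have ha : 0 < reg.a k := reg.a_pos k
    have h1 : (ℓ₀ k f : ℝ) * reg.a k ≤ reg.a k * ‖v‖ := (hkwin f).trans hfar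
    nlinarith
  exact hk S hS f v hv hℓ

/-- The split asks nothing new: the crux's core AS TYPED gives back the inward core (guard discarded). [folklore] -/
theorem inwardCore_of_core
    (h : ∀ (Nf : ℕ) (reg : QCDRegularisation Nf) (m : Fin Nf → ℝ), (∀ f, 0 < m f) →
      Input Nf reg m → Conclusion Nf reg m) : InwardCore := by
  intro Nf reg m hm hIn K
  obtain ⟨s, δ, C, hs0, hs1, hδ, hev⟩ := h Nf reg m hm hIn
  exact ⟨s, δ, C, hs0, hs1, hδ, hev.mono fun k hk S hS f v hv _ => hk S hS f v hv⟩

end Summit.QuantumFields.QCD.Theorems.FMClosureUnquenchedSplit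

end
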